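import Literature.MathematicalPhysics.QuantumFieldTheory.Balaban1983to89.FlowStep

/-!
# LENS-2 (gen 7) — the COCYCLE ∕ HISTORY-AGNOSTIC STEP spine of NODE v7 (`nodeO-cover/LENS-2-NODE-v7.md`)

Lens (ii) «the RG step as a MAP on admissible level-`k` data».  Kernel bookkeeping ONLY (FlowStep vocabulary; no record, no datum,
no chart): the typed content of «a history-agnostic one-step supplier closes the induction on the WHOLE BOX `]0,γ]^{k+1}`, the
`RGEqH` guard is never consumed; a run-guarded supplier does not» — i.e. the SUPPLIER-side reading of LOCATED-B.

* `StepOnBox γ P`   — the step available at EVERY box history, from the property at all strict prefixes.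
* `StepOnRuns γ β P` — the step available only ALONG in-window solutions of (0.20) (`RGEqH` + `Step.InInterval`).
* ★ `box_of_stepOnBox`   : `StepOnBox γ P → ∀ k v, v ∈ Box γ k → P k v`            (strong induction along prefixes).
* `run_of_box`           : box statement ⟹ flow-guarded statement (restriction; `RGEqH` unused).
* `stepOnRuns_of_stepOnBox`, `runs_of_stepOnRuns` : the run-guarded supplier and what it yields (runs only).
* ★ `exists_stepOnRuns_not_box` : a run-guarded supplier whose box statement FAILS (level-1 witness `P 1 v := v 0 = v 1`, `β ≡ 0`):
  the step-level twin of `K0V23Stub3RunBoxEquivalence.exists_hbeta_runAbs_not_box`.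
* rule (N) non-vacuity: `stepOnBox_lastPos` ∕ `not_lastPos_offBox`.

HONEST: elementary; nothing of Bałaban's analysis is asserted, ported or discharged; K0ᴬ stmt-QuantumFields-27238 ∕ K0⁷ -20541 OPEN;
finite 𝕋⁴ at fixed ε (rung R4); the Yang–Mills mass gap is NOT proved.  0 sorry · 0 axiom · 0 instance · 0 notation.
[cite: Balaban1987RG1, Thm 1 p.259 («we do not assume any special asymptotic behavior of the coupling constants»), (1.18) p.263
(«C^∞ function of g_{j−1} ∈ [0, γ] … uniformly»), Thm 3 p.264, (0.20) p.256]
-/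

namespace Summit.QuantumFields.YangMills.Cruxes.Record13SepCoPHInhabited.Lens2G7

open Literature.MathematicalPhysics.QuantumFieldTheory.Balaban1983to89
open Literature.MathematicalPhysics.QuantumFieldTheory.Balaban1983to89.FlowStep

/-- Restriction of a level-`k` history `(v_0, …, v_k)` to its level-`j` prefix, `j ≤ k`. [folklore] -/
def restrictTo {k : ℕ} (v : Fin (k + 1) → ℝ) (j : ℕ) (hj : j ≤ k) : Fin (j + 1) → ℝ :=
  fun i => v ⟨i, by omega⟩

/-- The prefix of a box history is a box history. [cite: Balaban1987RG1, §1 p.264 (bookkeeping)] -/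
theorem restrictTo_mem_box {γ : ℝ} {k : ℕ} {v : Fin (k + 1) → ℝ} (hv : v ∈ Box γ k) (j : ℕ) (hj : j ≤ k) :
    restrictTo v j hj ∈ Box γ j := by
  rw [mem_box] at hv ⊢
  intro i
  exact hv ⟨i, by omega⟩

/-- Prefixes of run prefixes are run prefixes. [folklore] -/
theorem restrictTo_prefixOf (g : ℕ → ℝ) (k j : ℕ) (hj : j ≤ k) :
    restrictTo (prefixOf g k) j hj = prefixOf g j := by
  funext i; rfl

/-- An in-window sequence has every prefix in the box. [cite: Balaban1987RG1, Thm 3 p.264 (bookkeeping)] -/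
theorem prefixOf_mem_box {γ : ℝ} {n : ℕ} {g : ℕ → ℝ} (hg : Step.InInterval γ n g) {k : ℕ} (hk : k ≤ n) :
    prefixOf g k ∈ Box γ k := by
  rw [mem_box]
  intro i
  have hi := i.isLt
  exact hg i (by omega)

/-- **HISTORY-AGNOSTIC (BOX) STEP SHAPE.**  `P k v` = «the level-`k` objects of record at the FREE history `v ∈ ]0,γ]^{k+1}` carry the
inductive letters» ([I] §1: (1.18)–(1.19) at format `E₀`); the step supplies `P` at level `k` from `P` at all strict prefixes, at EVERY box
history — the reading of [I] §2 «we assume that after k steps we have obtained the action A_k described in the previous section» with the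
couplings as free parameters in `]0, γ]` ((1.18): «C^∞ function of g_{j−1} ∈ [0, γ]»). [cite: Balaban1987RG1, (1.18) p.263, §2 p.265] -/
def StepOnBox (γ : ℝ) (P : (k : ℕ) → (Fin (k + 1) → ℝ) → Prop) : Prop :=
  ∀ k v, v ∈ Box γ k → (∀ j (hj : j < k), P j (restrictTo v j hj.le)) → P k v

/-- **RUN-GUARDED STEP SHAPE** — the same step available only along in-window solutions of (0.20) (27930⁸'s guard vocabulary
`RGEqH … → Step.InInterval γ …`, pieces read at `prefixOf g k`). [cite: Balaban1987RG1, (0.20) p.256, Thm 3 p.264] -/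
def StepOnRuns (γ : ℝ) (β : HBeta) (P : (k : ℕ) → (Fin (k + 1) → ℝ) → Prop) : Prop :=
  ∀ n g, RGEqH n β g → Step.InInterval γ n g →
    ∀ k, k ≤ n → (∀ j, j < k → P j (prefixOf g j)) → P k (prefixOf g k)

/-- ★ **COCYCLE LEMMA** — a history-agnostic step closes the induction on the WHOLE BOX, uniformly in the level: strong induction on `k`
along prefixes (`restrictTo_mem_box`).  No flow equation, no comparability, no kernel letter is consumed. [cite: Balaban1987RG1, Thm 3 p.264 (bookkeeping)] -/
theorem box_of_stepOnBox {γ : ℝ} {P : (k : ℕ) → (Fin (k + 1) → ℝ) → Prop} (h : StepOnBox γ P) :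
    ∀ k v, v ∈ Box γ k → P k v := by
  intro k
  refine Nat.strong_induction_on k ?_
  intro k ih v hv
  exact h k v hv fun j hj => ih j hj _ (restrictTo_mem_box hv j hj.le)

/-- **BOX ⟹ RUN** — the flow-guarded statement is the box statement restricted to run prefixes; `RGEqH` is not even needed.
(The β-letter instance is `K0V23Stub3RunwiseSuppliers.runAbsBound_of_absBox`.) [cite: Balaban1987RG1, Thm 3 p.264 (bookkeeping)] -/
theorem run_of_box {γ : ℝ} {P : (k : ℕ) → (Fin (k + 1) → ℝ) → Prop} (h : ∀ k v, v ∈ Box γ k → P k v)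
    (n : ℕ) (g : ℕ → ℝ) (hg : Step.InInterval γ n g) : ∀ k, k ≤ n → P k (prefixOf g k) :=
  fun _ hk => h _ _ (prefixOf_mem_box hg hk)

/-- The box supplier is the stronger supplier: it gives the run-guarded one by restriction. [folklore] -/
theorem stepOnRuns_of_stepOnBox {γ : ℝ} (β : HBeta) {P : (k : ℕ) → (Fin (k + 1) → ℝ) → Prop} (h : StepOnBox γ P) :
    StepOnRuns γ β P := by
  intro n g _ hg k hk ih
  refine h k (prefixOf g k) (prefixOf_mem_box hg hk) fun j hj => ?_
  rw [restrictTo_prefixOf]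
  exact ih j hj

/-- What a run-guarded supplier yields: the letters ALONG RUNS (strong induction on the level inside one run). [cite: Balaban1987RG1, Thm 3 p.264 (bookkeeping)] -/
theorem runs_of_stepOnRuns {γ : ℝ} {β : HBeta} {P : (k : ℕ) → (Fin (k + 1) → ℝ) → Prop} (h : StepOnRuns γ β P)
    (n : ℕ) (g : ℕ → ℝ) (hrg : RGEqH n β g) (hg : Step.InInterval γ n g) : ∀ k, k ≤ n → P k (prefixOf g k) := by
  intro k
  refine Nat.strong_induction_on k ?_
  intro k ih hk
  exact h n g hrg hg k hk fun j hj => ih j hj (by omega)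

/-- ★ **A RUN-GUARDED SUPPLIER DOES NOT GIVE THE BOX** (step-level twin of `exists_hbeta_runAbs_not_box`): with `β ≡ 0` every in-window
solution of (0.20) is CONSTANT, so the level-1 property «`v₀ = v₁`» is supplied along runs — and fails at the box history `(γ, γ/2)`.
So the guard in a supplier's text is NOT free: box-width must come from the supplier's PROOF being history-agnostic (`StepOnBox`), never from
a consumer-side upgrade of a run letter without extra letters. [cite: Balaban1987RG1, (0.20) p.256 (bookkeeping)] -/
theorem exists_stepOnRuns_not_box {γ : ℝ} (hγ : 0 < γ) :
    ∃ (β : HBeta) (P : (k : ℕ) → (Fin (k + 1) → ℝ) → Prop),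
      StepOnRuns γ β P ∧ ¬ ∀ k v, v ∈ Box γ k → P k v := by
  refine ⟨fun _ _ => 0, fun k v => k = 1 → v ⟨0, by omega⟩ = v ⟨k, by omega⟩, ?_, ?_⟩
  · intro n g hrg hg k hk _ h1
    subst h1
    have h0 := hrg 0 (by omega)
    simp only [zero_add, add_zero] at h0
    have hg0 := (hg 0 (by omega)).1
    have hg1 := (hg 1 hk).1
    have hsq : g 0 ^ 2 = g 1 ^ 2 := by
      have h0' : (g 0 ^ 2)⁻¹ = (g 1 ^ 2)⁻¹ := by simpa [one_div] using h0
      exact inv_inj.mp h0'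
    have heq : g 0 = g 1 := (pow_left_inj₀ hg0.le hg1.le two_ne_zero).mp hsq
    simp [prefixOf, heq]
  · intro hbox
    have hv : (fun i : Fin (1 + 1) => if (i : ℕ) = 0 then γ else γ / 2) ∈ Box γ 1 := by
      rw [mem_box]
      intro i
      by_cases hi : (i : ℕ) = 0
      · simp [hi, hγ]
      · simp only [hi, ↓reduceIte]
        constructor <;> linarith
    have h := hbox 1 _ hv rfl
    simp at h
    linarith

/-- Rule (N) NON-VACUITY: a property that is NOT everywhere true yet has the box step shape — «the last coupling is positive». [folklore] -/
theorem stepOnBox_lastPos (γ : ℝ) : StepOnBox γ fun k v => 0 < v (Fin.last k) :=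
  fun k _ hv _ => ((mem_box.mp hv) (Fin.last k)).1

/-- … and it does fail off the box. [folklore] -/
theorem not_lastPos_offBox : ¬ (fun (k : ℕ) (v : Fin (k + 1) → ℝ) => 0 < v (Fin.last k)) 0 (fun _ => -1) := by
  simp

/-- Rule (N): the cocycle lemma APPLIED — every box history has a positive last coupling (trivial, but it is the lemma's output shape). [folklore] -/
example (γ : ℝ) : ∀ k v, v ∈ Box γ k → 0 < v (Fin.last k) := box_of_stepOnBox (stepOnBox_lastPos γ)

end Summit.QuantumFields.YangMills.Cruxes.Record13SepCoPHInhabited.Lens2G7
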